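import Summits.Ventures.Crystal3D.Bulk.SphereCodeCut
import Mathlib.Analysis.InnerProductSpace.EuclideanDist
import Mathlib.Geometry.Euclidean.Angle.Unoriented.Basic
import HarnessLib

/-!
# The polar contraction AS PRINTED: `∠(Cx, s) = λ·∠(x, s)` and `d(Cx, Cy) ≥ λ·d(x, y)`

HONEST FRAMING. Part of the venture `Summits/Ventures/Crystal3D` (cell `pub-crystal3d`, phase 2;
seat typer-bulk). `Bulk/PolarContraction.lean` proves the contraction inequality in trigonometric
coordinates and `Bulk/SphereCodeCut.lean` consumes it through the half-tangent witness. This short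
file restates the result in the GEOMETRIC language of the cell's paper lemma
(`phase2/theory1/RANGE-CUT.md` §1, "CONTRACTION LEMMA. Let `s ∈ S²`, `λ ∈ (0,1]`,
`C : S² ∖ {−s} → S²` multiply the polar angle about `s` by `λ` (azimuth fixed). Then
`d(Cx, Cy) ≥ λ·d(x, y)`" — Böröczky–Szabó's device), with `C` realised by the tree's half-tangent
image map `TammesBridge.htImg (PolarContraction.contractProfile λ) Q` (`Bulk/HalfTanBridge.lean`,
p3 / idea-2) and `d` the angle `InnerProductGeometry.angle` (spherical distance of unit vectors):

* `angle_htImg_pole : angle (C x) Q = λ · angle x Q` — `C` multiplies the polar angle by `λ`;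
* `mul_angle_le_angle_htImg : λ · angle x y ≤ angle (C x) (C y)` — THE CONTRACTION LEMMA.

Both for unit `x, y` off the antipode `−Q` (`−1 < ⟪x, Q⟫`) and `0 ≤ λ ≤ 1`. Standard axioms;
nothing about packings is asserted here.
-/

noncomputable section

open scoped InnerProductSpace
open Real Set InnerProductGeometry

namespace Summit.Ventures.Crystal3D.PolarContraction

open TammesBridge

variable {lam : ℝ} {Q : EuclideanSpace ℝ (Fin 3)}

/-- The half-tangent abscissa `w = √((1−a)/(1+a))` of a unit vector at height `a = ⟪x, Q⟫ > −1`
encodes the polar angle `θ = 2·arctan w ∈ [0, π)`: `cos θ = a`, hence `angle x Q = 2·arctan w`. -/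
theorem angle_eq_two_mul_arctan (hQ : ‖Q‖ = 1) {x : EuclideanSpace ℝ (Fin 3)} (hx : ‖x‖ = 1)
    (ha : -1 < ⟪x, Q⟫_ℝ) : angle x Q = 2 * arctan (htW Q x) := by
  obtain ⟨hw0, -⟩ := htW_sq hQ hx ha
  obtain ⟨hid, -⟩ := htW_identities hQ hx ha
  set w := htW Q x with hw
  have ha0 : 0 ≤ arctan w := arctan_nonneg.2 hw0
  have haπ : arctan w < π / 2 := arctan_lt_pi_div_two w
  -- cos (2 arctan w) = (1 - w²)/(1 + w²) = ⟪x, Q⟫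
  have e1 : 1 - w ^ 2 = cos (2 * arctan w) * (1 + w ^ 2) := by
    have := one_sub_tan_sq (arctan w) (cos_arctan_pos w).ne'
    rwa [tan_arctan] at this
  have hpos : 0 < 1 + w ^ 2 := by positivity
  have hcos : cos (2 * arctan w) = ⟪x, Q⟫_ℝ := by
    have : cos (2 * arctan w) * (1 + w ^ 2) = ⟪x, Q⟫_ℝ * (1 + w ^ 2) := by rw [← e1, ← hid]; ring
    exact mul_right_cancel₀ hpos.ne' this
  rw [angle, hx, hQ, mul_one, div_one, ← hcos, arccos_cos (by linarith) (by linarith)]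

/-- **The contraction multiplies the polar angle by `λ`**: for the profile
`F = contractProfile λ` (`0 ≤ λ ≤ 1`), `angle (htImg F Q x) Q = λ · angle x Q`. -/
theorem angle_htImg_pole (h0 : 0 ≤ lam) (h1 : lam ≤ 1) (hQ : ‖Q‖ = 1) {x : EuclideanSpace ℝ (Fin 3)}
    (hx : ‖x‖ = 1) (ha : -1 < ⟪x, Q⟫_ℝ) :
    angle (htImg (contractProfile lam) Q x) Q = lam * angle x Q := by
  have hw0 := (htW_sq hQ hx ha).1
  set w := htW Q x with hw
  have hy1 : ‖htImg (contractProfile lam) Q x‖ = 1 := norm_htImg hQ (contractProfile_zero lam) hx ha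
  have hF : contractProfile lam w = tan (lam * arctan w) := by
    rw [contractProfile, max_eq_left hw0]
  obtain ⟨hb0, hb1⟩ := contract_angle_mem h0 h1 w
  rw [max_eq_left hw0] at hb0 hb1
  have hcosb : cos (lam * arctan w) ≠ 0 := (cos_pos_of_mem_Ioo ⟨by linarith [pi_pos], hb1⟩).ne'
  -- ⟪y, Q⟫ = (1 - W²)/(1 + W²) = cos (2 λ arctan w)
  have hinner : ⟪htImg (contractProfile lam) Q x, Q⟫_ℝ = cos (2 * (lam * arctan w)) := by
    rw [inner_htImg_Q hQ, htA, ← hw, hF]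
    have e2 := one_sub_tan_sq (lam * arctan w) hcosb
    have hpos : 0 < 1 + tan (lam * arctan w) ^ 2 := by positivity
    rw [e2, mul_div_assoc, div_self hpos.ne', mul_one]
  have haw : 0 ≤ arctan w := arctan_nonneg.2 hw0
  have hawπ : arctan w < π / 2 := arctan_lt_pi_div_two w
  rw [angle, hy1, hQ, mul_one, div_one, hinner, arccos_cos (by nlinarith) (by nlinarith),
    angle_eq_two_mul_arctan hQ hx ha, ← hw]
  ring

/-- **THE CONTRACTION LEMMA AS PRINTED** (Böröczky–Szabó; `RANGE-CUT.md` §1): for unit vectors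
`x, y` off the antipode of the pole `Q` and `0 ≤ λ ≤ 1`, the contraction `C = htImg
(contractProfile λ) Q` satisfies `λ · angle x y ≤ angle (C x) (C y)` — spherical distances shrink by
at most the factor `λ`. From `TammesBridge.exists_cos` (common longitude cosine) and
`PolarContraction.inner_contract_le`. -/
theorem mul_angle_le_angle_htImg (h0 : 0 ≤ lam) (h1 : lam ≤ 1) (hQ : ‖Q‖ = 1)
    {x y : EuclideanSpace ℝ (Fin 3)} (hx : ‖x‖ = 1) (hy : ‖y‖ = 1) (hax : -1 < ⟪x, Q⟫_ℝ)
    (hay : -1 < ⟪y, Q⟫_ℝ) :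
    lam * angle x y ≤ angle (htImg (contractProfile lam) Q x) (htImg (contractProfile lam) Q y) := by
  set F := contractProfile lam with hFdef
  have hFz : F 0 = 0 := contractProfile_zero lam
  obtain ⟨c, hc1, hc2, hX, hY⟩ := exists_cos (F := F) hQ hFz hx hy hax hay
  have hw₁0 := (htW_sq hQ hx hax).1
  have hw₂0 := (htW_sq hQ hy hay).1
  set w₁ := htW Q x with hw₁
  set w₂ := htW Q y with hw₂
  set a₁ := arctan w₁ with ha₁
  set a₂ := arctan w₂ with ha₂
  have ha₁0 : 0 ≤ a₁ := arctan_nonneg.2 hw₁0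
  have ha₂0 : 0 ≤ a₂ := arctan_nonneg.2 hw₂0
  have ha₁π : a₁ < π / 2 := arctan_lt_pi_div_two w₁
  have ha₂π : a₂ < π / 2 := arctan_lt_pi_div_two w₂
  -- original side: ⟪x, y⟫ = cos 2a₁ cos 2a₂ + sin 2a₁ sin 2a₂ c
  have e1 : 1 - w₁ ^ 2 = cos (2 * a₁) * (1 + w₁ ^ 2) := by
    rw [← tan_arctan w₁]; exact one_sub_tan_sq a₁ (cos_arctan_pos w₁).ne'
  have e2 : 1 - w₂ ^ 2 = cos (2 * a₂) * (1 + w₂ ^ 2) := by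
    rw [← tan_arctan w₂]; exact one_sub_tan_sq a₂ (cos_arctan_pos w₂).ne'
  have f1 : 2 * w₁ = sin (2 * a₁) * (1 + w₁ ^ 2) := by
    rw [← tan_arctan w₁]; exact two_mul_tan a₁ (cos_arctan_pos w₁).ne'
  have f2 : 2 * w₂ = sin (2 * a₂) * (1 + w₂ ^ 2) := by
    rw [← tan_arctan w₂]; exact two_mul_tan a₂ (cos_arctan_pos w₂).ne'
  set u : ℝ := cos (2 * a₁) * cos (2 * a₂) + sin (2 * a₁) * sin (2 * a₂) * c with hu
  have hP : 0 < (1 + w₁ ^ 2) * (1 + w₂ ^ 2) := by positivity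
  have hxy : ⟪x, y⟫_ℝ = u := by
    have key : (1 - w₁ ^ 2) * (1 - w₂ ^ 2) + 4 * w₁ * w₂ * c = u * ((1 + w₁ ^ 2) * (1 + w₂ ^ 2)) := by
      rw [show (4 : ℝ) * w₁ * w₂ * c = (2 * w₁) * (2 * w₂) * c by ring, e1, e2, f1, f2, hu]; ring
    have : ⟪x, y⟫_ℝ * ((1 + w₁ ^ 2) * (1 + w₂ ^ 2)) = u * ((1 + w₁ ^ 2) * (1 + w₂ ^ 2)) := by
      rw [← key, ← hX]; ring
    exact mul_right_cancel₀ hP.ne' this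
  -- contracted side: ⟪Cx, Cy⟫ = cos 2λa₁ cos 2λa₂ + sin 2λa₁ sin 2λa₂ c
  have hF1 : F w₁ = tan (lam * a₁) := by rw [hFdef, contractProfile, max_eq_left hw₁0]
  have hF2 : F w₂ = tan (lam * a₂) := by rw [hFdef, contractProfile, max_eq_left hw₂0]
  obtain ⟨hb₁0, hb₁1⟩ := contract_angle_mem h0 h1 w₁
  obtain ⟨hb₂0, hb₂1⟩ := contract_angle_mem h0 h1 w₂
  rw [max_eq_left hw₁0, ← ha₁] at hb₁0 hb₁1
  rw [max_eq_left hw₂0, ← ha₂] at hb₂0 hb₂1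
  have hcb₁ : cos (lam * a₁) ≠ 0 := (cos_pos_of_mem_Ioo ⟨by linarith [pi_pos], hb₁1⟩).ne'
  have hcb₂ : cos (lam * a₂) ≠ 0 := (cos_pos_of_mem_Ioo ⟨by linarith [pi_pos], hb₂1⟩).ne'
  have g1 := one_sub_tan_sq (lam * a₁) hcb₁
  have g2 := one_sub_tan_sq (lam * a₂) hcb₂
  have k1 := two_mul_tan (lam * a₁) hcb₁
  have k2 := two_mul_tan (lam * a₂) hcb₂
  set L : ℝ := cos (2 * (lam * a₁)) * cos (2 * (lam * a₂)) +
    sin (2 * (lam * a₁)) * sin (2 * (lam * a₂)) * c with hL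
  have hP' : 0 < (1 + tan (lam * a₁) ^ 2) * (1 + tan (lam * a₂) ^ 2) := by positivity
  have hyy : ⟪htImg F Q x, htImg F Q y⟫_ℝ = L := by
    have key' : (1 - tan (lam * a₁) ^ 2) * (1 - tan (lam * a₂) ^ 2) +
        4 * tan (lam * a₁) * tan (lam * a₂) * c =
        L * ((1 + tan (lam * a₁) ^ 2) * (1 + tan (lam * a₂) ^ 2)) := by
      rw [show (4 : ℝ) * tan (lam * a₁) * tan (lam * a₂) * c =
        (2 * tan (lam * a₁)) * (2 * tan (lam * a₂)) * c by ring, g1, g2, k1, k2, hL]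
      ring
    rw [hF1, hF2] at hY
    have : ⟪htImg F Q x, htImg F Q y⟫_ℝ * ((1 + tan (lam * a₁) ^ 2) * (1 + tan (lam * a₂) ^ 2)) =
        L * ((1 + tan (lam * a₁) ^ 2) * (1 + tan (lam * a₂) ^ 2)) := by
      rw [← key', ← hY]; ring
    exact mul_right_cancel₀ hP'.ne' this
  -- the contraction inequality
  have hθ₁ : 2 * a₁ ∈ Icc 0 π := ⟨by linarith, by linarith⟩
  have hθ₂ : 2 * a₂ ∈ Icc 0 π := ⟨by linarith, by linarith⟩
  have hcontr := inner_contract_le (c := c) h0 h1 hθ₁ hθ₂ ⟨hc1, hc2⟩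
  rw [show lam * (2 * a₁) = 2 * (lam * a₁) by ring, show lam * (2 * a₂) = 2 * (lam * a₂) by ring,
    ← hu, ← hL, ← hxy, ← hyy] at hcontr
  -- T λ ⟪x,y⟫ = cos (λ · angle x y); conclude with arccos antitone
  have hy1 : ‖htImg F Q x‖ = 1 := norm_htImg hQ hFz hx hax
  have hy2 : ‖htImg F Q y‖ = 1 := norm_htImg hQ hFz hy hay
  have hang : angle x y = arccos ⟪x, y⟫_ℝ := by rw [angle, hx, hy, mul_one, div_one]
  have hang' : angle (htImg F Q x) (htImg F Q y) = arccos ⟪htImg F Q x, htImg F Q y⟫_ℝ := by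
    rw [angle, hy1, hy2, mul_one, div_one]
  rw [hang, hang']
  have hlamθ0 : 0 ≤ lam * arccos ⟪x, y⟫_ℝ := mul_nonneg h0 (arccos_nonneg _)
  have hlamθπ : lam * arccos ⟪x, y⟫_ℝ ≤ π := by
    calc lam * arccos ⟪x, y⟫_ℝ ≤ 1 * arccos ⟪x, y⟫_ℝ :=
        mul_le_mul_of_nonneg_right h1 (arccos_nonneg _)
      _ ≤ π := by rw [one_mul]; exact arccos_le_pi _
  calc lam * arccos ⟪x, y⟫_ℝ = arccos (cos (lam * arccos ⟪x, y⟫_ℝ)) := (arccos_cos hlamθ0 hlamθπ).symm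
    _ = arccos (T lam ⟪x, y⟫_ℝ) := by rw [T]
    _ ≤ arccos ⟪htImg F Q x, htImg F Q y⟫_ℝ := arccos_le_arccos hcontr

end Summit.Ventures.Crystal3D.PolarContraction

end
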